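import Literature.NumberTheory.QuadraticFields.RealQuadraticFundamentalUnitCycle
import Literature.NumberTheory.QuadraticFields.RealQuadraticClassNumber1365
import HarnessLib

/-!
# Small norms are read off the principal cycle: an element of norm `±N`, `N < √D/4`, puts `Q = 2N` on the
# principal cycle — and a kernel check that it does not gives `h_K ≠ 1`

Topic `NumberTheory/QuadraticFields`, namespace `Literature.NumberTheory.QuadraticFields` (sub-namespace `QuadIrr` for the
continued fraction side, `Quadratic` for the field side); continues `RealQuadraticFundamentalUnit.lean` (Jacobson–Williams'
Legendre argument for the UNITS: every solution of `X² − DY² = ±4` is a power of `ε`, `exists_eq_fundUnit_pow`),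
`ReducedQuadraticIrrationalsConvergents.lean` (`exists_eq_psiProd_of_abs_sub_lt`: Legendre's criterion along the
expansion) and `RealQuadraticFundamentalUnitCycle.lean` (the computable step `cstep`). Everything here is PROVED
(theorems only; no definition, no named fact).

The same argument with a general small norm (Jacobson–Williams, *Solving the Pell Equation*, §3.3 with (3.18); classically
"if `|N| < √D` every solution of `x² − Dy² = N` is a convergent", here in the `𝒪_D`-normalisation `X² − DY² = ±4N` with
the principal quotient `δ = (q + √D)/2`):

* **`QuadIrr.exists_Q_eq_of_sq_sub_eq`** — if `X, Y ≥ 1` solve `X² − DY² = ±4N` with `N` square-free and `16N² < D`,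
  then `Q_{n+1} = 2N` for some `n`, i.e. `2N` is a denominator ON THE PRINCIPAL CYCLE of `δ` (`u/Y` with
  `X = 2u − qY` is a convergent of `δ` since `|δ − u/Y| = N/(ηY) < 1/(2Y²)` as `η = (X + Y√D)/2 > Y√D/2 > 2NY`;
  square-freeness makes `u/Y` reduced; the norm identity (3.18) gives `|Q_{n+1}|/2 = N`);
* `QuadIrr.iterate_Q_ne_of_check` — the kernel-checkable converse datum: if the computable expansion returns to `x₁` after
  `p` steps and none of `x₁, …, x_p` has `Q = 2N`, then no `Q_{n+1}` equals `2N`;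
* `Quadratic.normForm_natAbs_ne_of_check` — hence `|x² + txz − mz²| ≠ N` for all integers `x, z` (`t² + 4m = D`, `N ≥ 2`);
* **`Quadratic.classNumber_ne_one_of_check`** — for `[K:ℚ] = 2`, `d_K = D ≡ 1 (mod 4)`: if some `N ≥ 2` square-free with
  `16N² < D` is the norm of the ideal `(N, ω − k)` (`N·C = k² − k − (D−1)/4`) but `2N` is absent from the principal
  cycle, then `(N, ω − k)` is not principal (`not_isPrincipal_of_normForm_ne`) and `h_K ≠ 1`.

Instance (for the sequel, `h(ℚ(√170957)) = 3`): `D = 170957`, `N = 47` (`47·(−907) = 11² − 11 − 42739`), principal cycle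
of period `11` with denominators `Q/2 ∈ {1, 67, 97, 101, 157, 277}` — `classNumber_ne_one_of_discr_eq_170957`.

## References

* [JacobsonWilliams2008] M. J. Jacobson, Jr., H. C. Williams, *Solving the Pell Equation*, CMS Books in Mathematics,
  Springer (2009), §3.1 (3.18), §3.2 Thm. 3.2 (Legendre), §3.3 pp. 58–59, §5.3 Thm. 5.18.
* [Cox2013] D. A. Cox, *Primes of the form x² + ny²*, 2nd ed. (2013), §7.B Thm. 7.7.
-/

noncomputable section

open Module NumberField

namespace Literature.NumberTheory.QuadraticFields

namespace QuadIrr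

variable {D : ℕ}

/-- **Small norms sit on the principal cycle.** Let `D ≡ 0, 1 (mod 4)` be a non-square, `N` square-free with
`16N² < D`, and `X, Y ≥ 1` with `X² − DY² = ±4N`. Then `(step^[n+1] δ).Q = 2N` for some `n`, `δ = (q + √D)/2`:
with `X = 2u − qY` the fraction `u/Y` is a reduced convergent of `δ` (Legendre: `|δ − u/Y| = N/(ηY) < 1/(2Y²)`,
`η = (X + Y√D)/2 > 2NY`), so `u − Yδ̄ = ∏ψ_k`, whose norm `±N` is `(−1)^{n+1} Q_{n+1}/2` by (3.18).
[cite: JacobsonWilliams2008, §3.3 (pp. 58–59) with §3.1 (3.18) and §3.2 Thm. 3.2] -/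
theorem exists_Q_eq_of_sq_sub_eq (hD : ¬ IsSquare D) (hD4 : D % 4 = 0 ∨ D % 4 = 1) {N : ℕ} (hN : Squarefree N)
    (h16 : 16 * N ^ 2 < D) {X Y : ℤ} (hX : 1 ≤ X) (hY : 1 ≤ Y)
    (hXY : X ^ 2 - D * Y ^ 2 = 4 * N ∨ X ^ 2 - D * Y ^ 2 = -(4 * N)) :
    ∃ n : ℕ, (step^[n + 1] (principalStart D)).Q = 2 * N := by
  have h0 := isPreReduced_principalStart hD hD4
  have hN0 : N ≠ 0 := fun h => by rw [h] at hN; exact not_squarefree_zero hN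
  set q : ℤ := ((D % 2 : ℕ) : ℤ) with hq
  have hq01 : q = 0 ∨ q = 1 := by omega
  have hq2 : 2 ∣ (D : ℤ) - q := by
    have : ((D % 2 : ℕ) : ℤ) = (D : ℤ) % 2 := by push_cast; rfl
    omega
  have hq4 : 4 ∣ q ^ 2 - (D : ℤ) := by
    have : ((D % 2 : ℕ) : ℤ) = (D : ℤ) % 2 := by push_cast; rfl
    rcases hq01 with h | h <;> rw [h] <;> omega
  -- parity: `X = 2w + qY`
  have h4 : 2 ∣ X ^ 2 - D * Y ^ 2 := by
    rcases hXY with h | h <;> rw [h]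
    · exact ⟨2 * N, by ring⟩
    · exact ⟨-(2 * N), by ring⟩
  obtain ⟨w, hw⟩ := two_dvd_sub_mul hq2 h4
  obtain ⟨c, hc⟩ := hq4
  set u : ℤ := w + q * Y with hu
  -- real-number set-up
  have hsD : Real.sqrt (D : ℝ) ^ 2 = D := sqrt_sq
  have hD0 : 0 < Real.sqrt (D : ℝ) := sqrt_pos hD
  have hXr : (1 : ℝ) ≤ X := by exact_mod_cast hX
  have hYr : (1 : ℝ) ≤ Y := by exact_mod_cast hY
  have hNr : (1 : ℝ) ≤ N := by exact_mod_cast Nat.one_le_iff_ne_zero.mpr hN0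
  have hXY' : (X : ℝ) ^ 2 - D * (Y : ℝ) ^ 2 = 4 * N ∨ (X : ℝ) ^ 2 - D * (Y : ℝ) ^ 2 = -(4 * N) := by
    rcases hXY with h | h
    · left; exact_mod_cast h
    · right; exact_mod_cast h
  set η : ℝ := (X + Y * Real.sqrt D) / 2 with hη
  set η' : ℝ := (X - Y * Real.sqrt D) / 2 with hη'
  have hηη' : η * η' = N ∨ η * η' = -N := by
    rcases hXY' with h | h
    · left; rw [hη, hη']; nlinarith [h, hsD]
    · right; rw [hη, hη']; nlinarith [h, hsD]
  have hval : (principalStart D).val = (q + Real.sqrt D) / 2 := by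
    unfold val principalStart; push_cast; rfl
  have hconj : (principalStart D).conj = (q - Real.sqrt D) / 2 := by
    unfold conj principalStart; push_cast; rfl
  have hwr : (X : ℝ) = 2 * w + q * Y := by
    have : X = 2 * w + q * Y := by linarith
    exact_mod_cast this
  have hε : (u : ℝ) - Y * (principalStart D).conj = η := by
    rw [hconj, hη, hu, hwr]; push_cast; ring
  have hε' : (u : ℝ) - Y * (principalStart D).val = η' := by
    rw [hval, hη', hu, hwr]; push_cast; ring
  -- `η > 2NY` from `√D > 4N`
  have h4N : 4 * (N : ℝ) < Real.sqrt D := by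
    rw [Real.lt_sqrt (by positivity)]
    have : ((16 * N ^ 2 : ℕ) : ℝ) < D := by exact_mod_cast h16
    push_cast at this
    nlinarith [this]
  have hηY : 2 * (N : ℝ) * Y < η := by
    rw [hη]
    have : (Y : ℝ) * (4 * N) < Y * Real.sqrt D := mul_lt_mul_of_pos_left h4N (by linarith)
    nlinarith
  have hηpos : 0 < η := by
    have : (0 : ℝ) < 2 * N * Y := by positivity
    linarith
  have hY0 : (0 : ℝ) < Y := by linarith
  have happrox : |(principalStart D).val - u / Y| < 1 / (2 * (Y : ℝ) ^ 2) := by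
    have e : (principalStart D).val - u / Y = -η' / Y := by
      rw [← hε']; field_simp; ring
    have habs : |η'| = N / η := by
      have : |η * η'| = N := by rcases hηη' with h | h <;> simp [h]
      rw [abs_mul, abs_of_pos hηpos] at this
      field_simp; linarith
    rw [e, abs_div, abs_neg, habs, abs_of_pos hY0, div_div, div_lt_div_iff₀ (by positivity) (by positivity)]
    nlinarith
  -- coprimality from the norm equation `w u + c Y Y = ±N` and square-freeness of `N`
  have hnormZ : 4 * (w * u + c * Y * Y) = X ^ 2 - D * Y ^ 2 := by
    rw [hu, show X = 2 * w + q * Y by linarith]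
    linear_combination (-(Y ^ 2)) * hc
  have hwu : w * u + c * Y * Y = N ∨ w * u + c * Y * Y = -N := by
    rcases hXY with h | h <;> rw [h] at hnormZ
    · left; linarith
    · right; linarith
  have hcop : IsCoprime u Y := by
    rw [Int.isCoprime_iff_gcd_eq_one]
    set g : ℕ := Int.gcd u Y with hg
    have hgu : (g : ℤ) ∣ u := Int.gcd_dvd_left u Y
    have hgY : (g : ℤ) ∣ Y := Int.gcd_dvd_right u Y
    have hgw : (g : ℤ) ∣ w := by
      have : w = u - q * Y := by rw [hu]; ring
      rw [this]; exact dvd_sub hgu (dvd_mul_of_dvd_right hgY q)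
    have hgg : (g : ℤ) * g ∣ w * u + c * Y * Y :=
      dvd_add (mul_dvd_mul hgw hgu) (by rw [mul_assoc]; exact dvd_mul_of_dvd_right (mul_dvd_mul hgY hgY) c)
    have hggN : (g : ℤ) * g ∣ (N : ℤ) := by
      rcases hwu with h | h
      · rwa [h] at hgg
      · rw [h] at hgg; exact (dvd_neg.mp hgg)
    have hgN : g * g ∣ N := by exact_mod_cast hggN
    exact Nat.isUnit_iff.mp (hN g hgN)
  -- Legendre
  obtain ⟨n, hn1, hn2⟩ := exists_eq_psiProd_of_abs_sub_lt hD h0 (by linarith) hcop happrox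
  rw [hε] at hn1
  rw [hε'] at hn2
  -- the norm identity forces `|Q_{n+1}| = 2N`
  have hnorm := psiProd_mul_psiBarProd hD h0.isAdmissible (n + 1)
  rw [← hn1, ← hn2] at hnorm
  have hQpos : 0 < (step^[n + 1] (principalStart D)).Q := (h0.isReduced_iterate_succ hD n).1
  have hQ0 : ((principalStart D).Q : ℝ) = 2 := by simp [principalStart]
  rw [hQ0] at hnorm
  have habs : |((step^[n + 1] (principalStart D)).Q : ℝ)| = 2 * N := by
    have h1 : |η * η'| = N := by rcases hηη' with h | h <;> simp [h]
    rw [hnorm, abs_div, abs_mul, abs_pow, abs_neg, abs_one, one_pow, one_mul,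
      abs_of_pos (two_pos : (0 : ℝ) < 2)] at h1
    linarith
  rw [abs_of_pos (by exact_mod_cast hQpos)] at habs
  exact ⟨n, by exact_mod_cast habs⟩

/-- **The kernel-checkable converse datum.** If `s = ⌊√D⌋` (`s² < D < (s+1)²`), `D ≡ 0, 1 (mod 4)`, the computable
expansion returns to `x₁ = cstep δ` after `p > 0` steps, and none of `x₁, …, x_p` has `Q = 2N`, then no quotient
`step^[n+1] δ` of the principal expansion has `Q = 2N`. [cite: JacobsonWilliams2008, §3.3 Thm. 3.8 (pure periodicity)] -/
theorem iterate_Q_ne_of_check {s p N : ℕ} (hs1 : s * s < D) (hs2 : D < (s + 1) * (s + 1))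
    (hD4 : D % 4 = 0 ∨ D % 4 = 1) (hp : 0 < p)
    (hcyc : (cstep s)^[p] (cstep s (principalStart D)) = cstep s (principalStart D))
    (hne : ∀ k < p, ((cstep s)^[k] (cstep s (principalStart D))).Q ≠ 2 * N) (n : ℕ) :
    (step^[n + 1] (principalStart D)).Q ≠ 2 * N := by
  have hsq : s = Nat.sqrt D := Nat.eq_sqrt.mpr ⟨hs1.le, hs2⟩
  have hD : ¬ IsSquare D := fun ⟨r, hr⟩ => Nat.not_exists_sq hs1 hs2 ⟨r, hr.symm⟩
  have hred := isReduced_principalFirst hD hD4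
  have h1 : principalFirst D = cstep s (principalStart D) := step_eq_cstep hsq (by simp [principalStart])
  have hiter : ∀ m, step^[m] (principalFirst D) = (cstep s)^[m] (cstep s (principalStart D)) := fun m => by
    rw [iterate_step_eq_iterate_cstep hD hsq hred m, h1]
  have hper : Function.IsPeriodicPt step p (principalFirst D) := by
    change step^[p] (principalFirst D) = principalFirst D
    rw [hiter, hcyc, h1]
  rw [iterate_succ_principalStart, ← hper.iterate_mod_apply, hiter]
  exact hne _ (Nat.mod_lt _ hp)

end QuadIrr

namespace Quadratic

open QuadIrr

/-- **The norm form misses `N`.** With `t² + 4m = D` (`D ≡ 0, 1 (mod 4)` a non-square), `N ≥ 2` square-free,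
`16N² < D`, and the cycle check of `iterate_Q_ne_of_check`: `|x² + txz − mz²| ≠ N` for all integers `x, z`
(`4(x² + txz − mz²) = (2x + tz)² − Dz²`, and `z = 0` or `2x + tz = 0` would make `N` a square or `D ≤ 4N`).
[cite: JacobsonWilliams2008, §3.3 (pp. 58–59) with §3.1 (3.18)] -/
theorem normForm_natAbs_ne_of_check {D s p N : ℕ} {t m : ℤ} (hDt : (D : ℤ) = t ^ 2 + 4 * m)
    (hs1 : s * s < D) (hs2 : D < (s + 1) * (s + 1)) (hD4 : D % 4 = 0 ∨ D % 4 = 1) (hp : 0 < p)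
    (hcyc : (cstep s)^[p] (cstep s (principalStart D)) = cstep s (principalStart D))
    (hne : ∀ k < p, ((cstep s)^[k] (cstep s (principalStart D))).Q ≠ 2 * N)
    (hN : Squarefree N) (h2N : 2 ≤ N) (h16 : 16 * N ^ 2 < D) (x z : ℤ) :
    (x ^ 2 + t * x * z - m * z ^ 2).natAbs ≠ N := by
  have hD : ¬ IsSquare D := fun ⟨r, hr⟩ => Nat.not_exists_sq hs1 hs2 ⟨r, hr.symm⟩
  intro hx
  have hx' : x ^ 2 + t * x * z - m * z ^ 2 = N ∨ x ^ 2 + t * x * z - m * z ^ 2 = -N := by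
    rcases Int.natAbs_eq (x ^ 2 + t * x * z - m * z ^ 2) with h | h
    · left; rw [h, hx]
    · right; rw [h, hx]
  -- `X = |2x + tz|`, `Y = |z|`
  set X : ℤ := |2 * x + t * z| with hXdef
  set Y : ℤ := |z| with hYdef
  have hXY : X ^ 2 - D * Y ^ 2 = 4 * N ∨ X ^ 2 - D * Y ^ 2 = -(4 * N) := by
    rw [hXdef, hYdef, sq_abs, sq_abs, hDt]
    rcases hx' with h | h
    · left; linear_combination 4 * h
    · right; linear_combination 4 * h
  -- `Y ≥ 1`: otherwise `x² = ±N`, `N` a square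
  have hY : 1 ≤ Y := by
    by_contra hY0
    have hz : z = 0 := by rw [hYdef] at hY0; by_contra h; exact hY0 (Int.one_le_abs h)
    rw [hz] at hx'
    simp only [mul_zero, add_zero, sub_zero, zero_pow two_ne_zero] at hx'
    have hN2 : (2 : ℤ) ≤ N := by exact_mod_cast h2N
    have hxN : x * x = N := by
      rcases hx' with h | h
      · rw [← h]; ring
      · nlinarith [sq_nonneg x]
    have hdvd : x.natAbs * x.natAbs ∣ N := by
      have h' : ((x.natAbs * x.natAbs : ℕ) : ℤ) = (N : ℤ) := by rw [Int.natAbs_mul_self]; exact hxN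
      have h'' : x.natAbs * x.natAbs = N := by exact_mod_cast h'
      exact h'' ▸ dvd_rfl
    have hu := hN _ hdvd
    rw [Nat.isUnit_iff] at hu
    have h1 : ((x.natAbs * x.natAbs : ℕ) : ℤ) = 1 := by rw [hu]; norm_num
    rw [Int.natAbs_mul_self, hxN] at h1
    omega
  -- `X ≥ 1`: otherwise `Dz² = 4N ≤ 16N² < D ≤ Dz²`
  have hX : 1 ≤ X := by
    by_contra hX0
    have h0 : 2 * x + t * z = 0 := by rw [hXdef] at hX0; by_contra h; exact hX0 (Int.one_le_abs h)
    have hX0' : X = 0 := by rw [hXdef, h0, abs_zero]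
    rw [hX0'] at hXY
    have hY2 : 1 ≤ Y ^ 2 := by nlinarith
    have hDpos : (0 : ℤ) < D := by exact_mod_cast (show 0 < D by omega)
    have hN1 : (1 : ℤ) ≤ N := by exact_mod_cast (show 1 ≤ N by omega)
    have h16' : (16 : ℤ) * N ^ 2 < D := by exact_mod_cast h16
    rcases hXY with h | h <;> nlinarith
  obtain ⟨n, hn⟩ := exists_Q_eq_of_sq_sub_eq hD hD4 hN h16 hX hY hXY
  exact iterate_Q_ne_of_check hs1 hs2 hD4 hp hcyc hne n hn

section Field

variable {K : Type*} [Field K] [NumberField K]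

/-- **`h_K ≠ 1` by a principal-cycle check.** Let `[K:ℚ] = 2`, `d_K = D ≡ 1 (mod 4)` (normalised basis
`ω² = ω + (D−1)/4`), `N ≥ 2` square-free with `16N² < D` and `N·C = k² − k − (D−1)/4` (so the ideal `(N, ω − k)` has
norm `N`). If the computable principal cycle of `D` (period `p`, `s = ⌊√D⌋`) has no denominator `Q = 2N`, then
`(N, ω − k)` is not principal and `h_K ≠ 1`. [cite: JacobsonWilliams2008, §5.3 Thm. 5.18 with §3.3] -/
theorem classNumber_ne_one_of_check (h2 : finrank ℚ K = 2) {D s p N : ℕ} (hdisc : NumberField.discr K = D)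
    (hD1 : D % 4 = 1) (hs1 : s * s < D) (hs2 : D < (s + 1) * (s + 1)) (hp : 0 < p)
    (hcyc : (cstep s)^[p] (cstep s (principalStart D)) = cstep s (principalStart D))
    (hne : ∀ k < p, ((cstep s)^[k] (cstep s (principalStart D))).Q ≠ 2 * N)
    (hN : Squarefree N) (h2N : 2 ≤ N) (h16 : 16 * N ^ 2 < D) {k C : ℤ}
    (hkC : (N : ℤ) * C = k ^ 2 - 1 * k - ((D : ℤ) - 1) / 4) :
    NumberField.classNumber K ≠ 1 := by
  have hd1 : NumberField.discr K % 4 = 1 := by rw [hdisc]; exact_mod_cast hD1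
  obtain ⟨b, hb, hω⟩ := exists_basis_sq_eq_add_of_emod_four_eq_one h2 hd1
  rw [hdisc] at hω
  have hDt : (D : ℤ) = 1 ^ 2 + 4 * (((D : ℤ) - 1) / 4) := by omega
  have hI : Ideal.absNorm (Ideal.span {((N : ℤ) : 𝓞 K), b 1 - (k : 𝓞 K)}) = N := by
    rw [absNorm_span_pair_eq b hb hω hkC]; rfl
  intro h1
  haveI : IsPrincipalIdealRing (𝓞 K) := (NumberField.classNumber_eq_one_iff (K := K)).mp h1
  exact not_isPrincipal_of_normForm_ne b hb hω hI
    (normForm_natAbs_ne_of_check hDt hs1 hs2 (Or.inr hD1) hp hcyc hne hN h2N h16)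
    (IsPrincipalIdealRing.principal _)

/-- **`h(ℚ(√170957)) ≠ 1`**: `170957` (prime, `≡ 5 (mod 8)`, the rung `D_43^+`) has principal cycle of period `11` with
denominators `Q/2 ∈ {1, 67, 97, 101, 157, 277}`; the split prime `47` (`47·(−907) = 11² − 11 − 42739`, `16·47² < D`) is
absent, so `(47, ω − 11)` is not principal. [cite: JacobsonWilliams2008, §5.3 Thm. 5.18] -/
theorem classNumber_ne_one_of_discr_eq_170957 (h2 : finrank ℚ K = 2) (hd : NumberField.discr K = 170957) :
    NumberField.classNumber K ≠ 1 :=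
  classNumber_ne_one_of_check h2 (D := 170957) (s := 413) (p := 11) (N := 47) (k := 11) (C := -907)
    (by exact_mod_cast hd) (by norm_num) (by norm_num) (by norm_num) (by norm_num) (by decide +kernel)
    (by decide +kernel) (Nat.prime_iff.mp (by norm_num)).squarefree (by norm_num) (by norm_num) (by norm_num)

end Field

end Quadratic

end Literature.NumberTheory.QuadraticFields

end
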